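import Summits.BirchSwinnertonDyer.BirchSwinnertonDyer.Theses.PrintX8VSC
import Summits.BirchSwinnertonDyer.BirchSwinnertonDyer.Theorems.PrintX8VSInputHondaSystemPrimalPadic
import Summits.BirchSwinnertonDyer.BirchSwinnertonDyer.Theorems.PrintX8VSInputHondaSystemPrimalTransport
import Summits.BirchSwinnertonDyer.BirchSwinnertonDyer.Theorems.PrintX8VSInputHondaSystemDualClauses
import HarnessLib

/-!
# Route `PrintX8VSC` (print-keyed repair twin of `PrintX8VS`; born 2026-08-28T22:36Z), aside item stmt-BirchSwinnertonDyer-23750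
# `InputHondaSystem` — Sprung 2012 Thm. 2.2 (existence of a Honda system) — PROVED, by the kernel proof already landed for its
# `PrintX8VS` / `PrintX8` twin item 20413 (`Theorems.thm22_exists_isHondaSystem_holds`, INPUTS seat `bsd-inputs-honda-p1`)

Cell `bsd-ssimc`, width seat `cruxlead-stmt-BirchSwinnertonDyer-19875-w3` (gen 10) under the 19875 LEAD. The born aside decl
`PrintX8VSC.InputHondaSystem` unfolds to the named fact `Sprung2012.thm22_exists_isHondaSystem`, which is a tree THEOREM: the proof of
`Theorems/PrintX8VSInputHondaSystem.lean` (route files `PrintX8VS`/`PrintX8` imported there) is repeated here token for token over its three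
ROUTE-FREE helper files (`…InputHondaSystemPrimalPadic`, `…PrimalTransport`, `…DualClauses`: the primal Honda data in the `p`-adic model,
their transport to `ℚ_v`, and Sprung's relations), so that this closer imports only the `PrintX8VSC` route file. Effect: the route's
displayed print input «Honda system» (conjunct (ii) of `PublishedInputsX8Contra`) is a theorem, not a citation. HONEST FRAMING: no new
mathematics in this file; BSD / K′ / C′ / MC′ untouched.

References: [Sprung2012] Thm. 2.2 (p. 1487), Cor. 2.10 (p. 1489); [Kobayashi2003] Lemma 8.9, Prop. 8.11, Prop. 8.12; route file
`Theses/PrintX8VSC.lean` (rev 2, item 23750); tree `Theorems/PrintX8VSInputHondaSystem.lean` (twin closer, item 20413).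
-/

set_option autoImplicit false
-- justification: the mandated namespace `Summit.BirchSwinnertonDyer.BirchSwinnertonDyer.Theorems`
-- (single-conjunct summit, Sub = Summit) repeats a segment by design (D-0017).
set_option linter.dupNamespace false

noncomputable section

namespace Summit.BirchSwinnertonDyer.BirchSwinnertonDyer.Theorems.PrintX8VSCGlue

open Literature Literature.NumberTheory.EllipticCurves
  Summit.BirchSwinnertonDyer.BirchSwinnertonDyer.Theorems
  Summit.BirchSwinnertonDyer.BirchSwinnertonDyer.Theses.PrintX8VSC

/-- **Item stmt-BirchSwinnertonDyer-23750 `PrintX8VSC.InputHondaSystem` — Sprung 2012 Thm. 2.2 — holds**: for `W/ℚ` elliptic and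
globally minimal, `p ≠ 2` of good reduction with `p ∣ a_p`, a cyclotomic `κ` with topological generator `γ`, the place `v ∋ p` and a local
lift `g` of the generator, there is a Honda system `(c_{−1}, (c_n)_n)`. Proof = `Theorems.thm22_exists_isHondaSystem_holds` token for token
(primal Honda data in the `p`-adic model, transported to `ℚ_v`, `IsHondaSystem` from the primal relations). Unconditional.
[cite: Sprung2012, Thm. 2.2 (p. 1487), Cor. 2.10 (p. 1489)] [cite: Kobayashi2003, Lemma 8.9, Prop. 8.11, Prop. 8.12] -/
theorem inputHondaSystem_holds : Theses.PrintX8VSC.InputHondaSystem := by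
  unfold Theses.PrintX8VSC.InputHondaSystem
  intro W _ _ p _ hp2 hgood hap κ γ hκ _ _ v hv g hg
  obtain ⟨cneg, c, N, hN, hcneg, hc, hR0, hR1, hRn, hGEN, hGEN0⟩ :=
    SprungHonda.primalHonda_adicCompletion_of_padic W κ (W.frobeniusTrace p) v hv
      (fun ι ↦ SprungHonda.exists_primalHonda_padic W hp2 hgood hap κ hκ ι)
  exact ⟨cneg, c, SprungHonda.isHondaSystem_of_primal κ (closureEmb (K := ℚ) (v.adicCompletion ℚ)) W
    (SprungHonda.intCast_sub_two_isUnit_of_dvd hp2 hap).2 hg hN hcneg hc hR0 hR1 hRn hGEN hGEN0⟩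

end Summit.BirchSwinnertonDyer.BirchSwinnertonDyer.Theorems.PrintX8VSCGlue

end
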